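import Mathlib
import Summits.ResolutionOfSingularities.ResolutionOfSingularities.Theorems.WeightedInvariantLocalWeightedDropNCResSurfGraphLoopStep
import Summits.ResolutionOfSingularities.ResolutionOfSingularities.Theorems.WeightedInvariantLocalWeightedDropNCResSurfGraphSwap
import Summits.ResolutionOfSingularities.ResolutionOfSingularities.Theorems.WeightedInvariantLocalWeightedDropTOT2NearPlaneSetting
import Summits.ResolutionOfSingularities.ResolutionOfSingularities.Theorems.WeightedInvariantLocalWeightedDropSpaceCountGame

/-!
# `WeightedInvariant.LocalWeightedDrop`: NC-resolution settings for the TOT₂ line — GRAPH SURFACES, part 15: THE POINT-MOVE CLAUSE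
# (parts 5–8 and 6a assembled into one `MoveClause` of the count game: every answer drops the head or returns a graph-surface state)

Crux item stmt-ResolutionOfSingularities-8899 `LocalWeightedDrop` (route `ResolutionOfSingularities/WeightedInvariant`), ENGINE skeleton v32/v33, residuals
`stub_spaceNCRankDrop` / `stub_wildWideApexFourStartsWon` (res-L1-w43-strat-1's line `directrix-cut` v3.1, piece PL = `ApexPlaneExit`, SURFACE sub-case;
design memo `L/res-L1-w43-stub-4/g5/S-E2-SURF.md`).  [OURS · L1 W4.3 · chain w43 · seat res-L1-w43-stub-4 gen 5; one bookkeeping definition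
(`SurfState`, the loop invariant) + the clause; on res-L1-w43-stub-1's S-SET (`admissible_transform`, `Decoration.head_transform_le`,
`Decoration.totalO_chart_eq`, `MoveClause`); the count game is the programme's own; nothing here is a statement of any manuscript; AI-produced,
gate-checked, weaker than expert review.]

* `SurfState δ` — THE LOOP INVARIANT of S-E2-SURF on a decoration: some graph surface `(a, b, ψ)` (`a ≠ b`, `ψ_j(0) = 0` off the base) is
  permissible at order `c` for the product `g = f·∏_O x_l`, and `g` has apex dimension `≤ 2`;
* **`pointMove_clause`** — from an admissibly decorated `(b₀, δ)` in `SurfState δ`, the identity point move satisfies the `MoveClause` with the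
  goal «admissibly decorated, and the head dropped or (same head and `SurfState`)»: parts 5 (answer in the tangent plane), 8 (swap so that the live
  slot is the first base letter), 7 (the successor surface), 6a (`e ≤ 2` persists).
-/

set_option linter.dupNamespace false -- mandated namespace of this single-conjunct summit

noncomputable section

namespace Summit.ResolutionOfSingularities.ResolutionOfSingularities.Theorems

namespace TameFourTupleDrop

namespace GraphSurf

open MvPowerSeries Literature.AlgebraicGeometry.Resolution

variable {k : Type} [Field k] {m : ℕ}

/-- THE LOOP INVARIANT OF S-E2-SURF: a permissible graph surface for the product and apex dimension `≤ 2`. [OURS] -/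
def SurfState (δ : Decoration k m) : Prop :=
  (∃ (a b : Fin (m + 1)) (ψ : Fin (m + 1) → MvPowerSeries (Fin 2) k), a ≠ b ∧ (∀ j, ¬ (j = a ∨ j = b) → constantCoeff (ψ j) = 0) ∧
    InOffPlaneIdeal a b δ.c (subst (shear a b ψ) (δ.f * ∏ l ∈ δ.O, X l))) ∧
  ∀ u₁ u₂ u₃ : Fin (m + 1) → k,
    (∀ v, CobordantChart.initEval (fun _ : Fin (m + 1) => 1) (v + u₁) δ.c (δ.f * ∏ l ∈ δ.O, X l) =
      CobordantChart.initEval (fun _ : Fin (m + 1) => 1) v δ.c (δ.f * ∏ l ∈ δ.O, X l)) →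
    (∀ v, CobordantChart.initEval (fun _ : Fin (m + 1) => 1) (v + u₂) δ.c (δ.f * ∏ l ∈ δ.O, X l) =
      CobordantChart.initEval (fun _ : Fin (m + 1) => 1) v δ.c (δ.f * ∏ l ∈ δ.O, X l)) →
    (∀ v, CobordantChart.initEval (fun _ : Fin (m + 1) => 1) (v + u₃) δ.c (δ.f * ∏ l ∈ δ.O, X l) =
      CobordantChart.initEval (fun _ : Fin (m + 1) => 1) v δ.c (δ.f * ∏ l ∈ δ.O, X l)) →
    ∃ α β γ : k, (α ≠ 0 ∨ β ≠ 0 ∨ γ ≠ 0) ∧ α • u₁ + β • u₂ + γ • u₃ = 0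

/-- The transported base letter is not the exceptional letter. -/
theorem predAbove_succ_ne_zero' {a b : Fin (m + 1)} (hab : a ≠ b) : Fin.predAbove a b.succ ≠ 0 := by
  obtain ⟨q, hq⟩ := Fin.exists_succAbove_eq (Ne.symm hab)
  rw [← hq, RestrictedChartTransport.predAbove_succAbove_succ]
  exact Fin.succ_ne_zero q

/-- **THE POINT-MOVE CLAUSE OF S-E2-SURF** (OURS · L1 W4.3).  From an admissibly decorated `(b₀, δ)` in `SurfState δ` (`k` infinite), the identity
point move satisfies the count game's `MoveClause` for the goal «the successor germ is admissibly decorated by some `δ′` with `δ′.head < δ.head`, or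
with the same head and `SurfState δ′`»: at an answer `c`, pick any live slot; if the head did not drop there, `c` lies in the tangent plane (part 5),
so — after swapping the base letters if necessary (part 8) — `c_a ≠ 0`; read at the slot `a`, either the head dropped or the successor carries the
strict transform of the surface (part 7) and apex dimension `≤ 2` (part 6a). -/
theorem pointMove_clause [Infinite k] {b₀ : MvPowerSeries (Fin (m + 1)) k} {δ : Decoration k m} (hadm : Admissible b₀ δ) (hS : SurfState δ) :
    MoveClause b₀ (fun j => (X j : MvPowerSeries (Fin (m + 1)) k)) (fun _ => 1)
      (fun b' => ∃ δ' : Decoration k m, Admissible b' δ' ∧ (δ'.head < δ.head ∨ (δ'.head = δ.head ∧ SurfState δ'))) := by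
  classical
  obtain ⟨⟨a₀, b₁, ψ₀, hab₀, hψ₀, hperm₀⟩, htwo⟩ := hS
  have hf : δ.f ≠ 0 := hadm.2.1.ne_zero
  have hpermX := isBPermissible_point_X δ
  have hconv : ∀ (c : Fin (m + 1) → k) (l : Fin (m + 1)), (fun _ : Fin (m + 1) => (1 : ℕ)) l = 0 → c l = 0 :=
    fun _ _ h => absurd h one_ne_zero
  have hXg : subst (fun j => (X j : MvPowerSeries (Fin (m + 1)) k)) (δ.f * ∏ l ∈ δ.O, X l) = δ.f * ∏ l ∈ δ.O, X l :=
    congrFun subst_self _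
  intro c hc0 hcne A G hfac hG
  have hgen : ∀ s, c s ≠ 0 →
      Admissible (X 0 * TupleGame.slice s G) (δ.transform (fun j => (X j : MvPowerSeries (Fin (m + 1)) k)) (fun _ => 1) c s) ∧
        (δ.transform (fun j => (X j : MvPowerSeries (Fin (m + 1)) k)) (fun _ => 1) c s).head ≤ δ.head := fun s hs =>
    ⟨admissible_transform hadm hpermX (hconv c) hfac hG hs, Decoration.head_transform_le hpermX (hconv c) hf hs⟩
  -- any live slot: if the head dropped there, done
  obtain ⟨s₀, hs₀⟩ : ∃ s, c s ≠ 0 := Function.ne_iff.mp hcne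
  by_cases hlt₀ : (δ.transform (fun j => (X j : MvPowerSeries (Fin (m + 1)) k)) (fun _ => 1) c s₀).head < δ.head
  · exact ⟨s₀, hs₀, _, (hgen s₀ hs₀).1, Or.inl hlt₀⟩
  have hhead₀ : (δ.transform (fun j => (X j : MvPowerSeries (Fin (m + 1)) k)) (fun _ => 1) c s₀).head = δ.head :=
    le_antisymm (hgen s₀ hs₀).2 (not_lt.mp hlt₀)
  -- the answer lies in the tangent plane of the surface
  obtain ⟨H, U, hfacH, hH, -, -⟩ := Decoration.totalO_chart_eq hpermX (hconv c) hf hs₀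
  rw [hXg] at hfacH
  obtain ⟨hc', hab0⟩ := tangentPlane_answer_of_head_eq hadm hab₀ hψ₀ hperm₀ htwo hs₀ hfacH hH hhead₀
  -- reading at the first base slot, after a swap if necessary
  suffices key : ∀ (a b : Fin (m + 1)) (ψ : Fin (m + 1) → MvPowerSeries (Fin 2) k), a ≠ b →
      (∀ j, ¬ (j = a ∨ j = b) → constantCoeff (ψ j) = 0) → InOffPlaneIdeal a b δ.c (subst (shear a b ψ) (δ.f * ∏ l ∈ δ.O, X l)) →
      c = c a • tangentL a b ψ + c b • tangentR a b ψ → c a ≠ 0 →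
      ∃ i : Fin (m + 1), c i ≠ 0 ∧ ∃ δ' : Decoration k m, Admissible (X 0 * TupleGame.slice i G) δ' ∧
        (δ'.head < δ.head ∨ (δ'.head = δ.head ∧ SurfState δ')) by
    rcases hab0 with ha | hb
    · exact key a₀ b₁ ψ₀ hab₀ hψ₀ hperm₀ hc' ha
    · refine key b₁ a₀ (fun j => subst (![X 1, X 0] : Fin 2 → MvPowerSeries (Fin 2) k) (ψ₀ j)) hab₀.symm (constantCoeff_swap_of_ne hψ₀) ?_
        (eq_combo_tangent_swap hab₀ hc') hb
      rw [← shear_swap]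
      exact hperm₀.symm
  intro a b ψ hab hψ hperm hc' hca
  refine ⟨a, hca, _, (hgen a hca).1, ?_⟩
  by_cases hlt : (δ.transform (fun j => (X j : MvPowerSeries (Fin (m + 1)) k)) (fun _ => 1) c a).head < δ.head
  · exact Or.inl hlt
  have hhead : (δ.transform (fun j => (X j : MvPowerSeries (Fin (m + 1)) k)) (fun _ => 1) c a).head = δ.head :=
    le_antisymm (hgen a hca).2 (not_lt.mp hlt)
  have hcoord : ∀ j, ¬ (j = a ∨ j = b) → c j = c a * coeff (Finsupp.single 0 1) (ψ j) + c b * coeff (Finsupp.single 1 1) (ψ j) :=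
    fun j hj => answer_apply_of_eq_combo_tangent hc' hj
  refine Or.inr ⟨hhead, ⟨Fin.predAbove a b.succ, 0, step₂ a b ψ c, predAbove_succ_ne_zero' hab,
    constantCoeff_step₂_of_ne ψ hcoord, inOffPlaneIdeal_transform hab hadm hψ hperm hc' hca hhead⟩,
    apexPlane_transform_of_head_eq hadm htwo hca hhead (hgen a hca).1⟩

end GraphSurf

end TameFourTupleDrop

end Summit.ResolutionOfSingularities.ResolutionOfSingularities.Theorems

end
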